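import Mathlib.Analysis.SpecialFunctions.Pow.Real

/-!
# EriceRemainderEnclosureHistoryAutonomyComparisonWindowLimit — THE «ONLY IF» OF THE WINDOW CONJECTURE (E58b-W): two ages at ratio `134` with weights
# `1 : 17∕5` have profile sum `Σ_j L_j∕P_j > 2.0001 > 2`, so (E58b)'s profile condition — which `…ComparisonKernelChord` proves for EVERY profile on a
# window of ratio `≤ 133` — covers no window of ratio `134`: the factor `133` is exactly the reach of the profile-condition road

Cell `pub-balaban`, β-function sub-cell, BINDER row D4 «RemainderConst leaves for Bałaban's split» (`HOME/BINDER-OWNERS.md`; owner lineage `b2b-balaban-beta-an4`;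
this file by co-owner #3 lineage `b2b-balaban-beta-d4-p3`, generation 101, road P3), β-FLOW TEAM duty (1), FREEZE (0) honoured (def-free; Mathlib only; nothing
restated).  Fifth file of gen 101's station (P3·W) (`…KernelEnergy` p572068, `…WindowHundred` p572742, `…KernelPSD` p573567, `…KernelChord` p575206).

HONEST FRAMING (page 1, verbatim and binding).  *"Discharging BetaPertH makes Bałaban's UV stability UNCONDITIONAL — a real constructive-QFT result; it is
NOT the continuum limit and NOT the Clay problem."*  THIS FILE DISCHARGES NOTHING OF THE KIND.  One explicit finite sum with square roots, about the cell's own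
NOT-IN-PRINT comparison binder (conjecture (E58′)); nothing of Bałaban's asserted.  NOTE: the profile condition is SUFFICIENT for comparison, not necessary —
this file does NOT refute comparison (E58′) for ages at ratio `134` (d4-p2's tower ∕ slack files (E62)–(E64) prove comparison for far-apart ages by other
bookkeeping); it only marks where THIS road ends.  Row D4 class UNCHANGED (critical-path width 0; instance 0∕1; D4 DISCHARGE NO DATE).  HONEST DEPENDENCY:
continuum YM on T⁴ ⇐ BetaPertH ∧ nine spine estimates (0/9 proved); BetaPertH ⇐ (D1) ∧ (D4) ∧ CAP+tail; G-an2-4 gates asym, D1 and NE2/3/4.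

THE POINT (census sense (α)).  By `…ComparisonKernelEnergy` ∕ `…KernelPSD` the supremum of `Σ_j L_j∕P_j` over profiles on two ages at ratio `R` is
`2∕(ρ + R^{1∕4}∕√(1+R))`, attained at weights `1 : R^{1∕4}`, crossing `2` at `R = 133.87…`.  Here the witness at the first integer ratio beyond: `R = 134`,
rational weights `1 : 17∕5`: `P_1 = √(1∕2) + (17∕5)√(1∕135) < 0.999735`, `P_134 = √(134∕135) + (17∕5)√(1∕2) < 3.400461`, so
`1∕P_1 + (17∕5)∕P_134 > 1.000265 + 0.999864 > 2` (`two_lt_profileSum_ratio_134`, in the letter of (E58b)'s hypothesis `hP` with `K = 135`, `K₀ = 1`).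

WHAT IS PROVED ([folklore]; 0 `def`, 0 sorry).  **`two_lt_profileSum_ratio_134`**.
-/
noncomputable section
open Finset

namespace Summit.QuantumFields.BalabanUV.Beta.EriceRemainderEnclosureHistoryAutonomyComparisonWindowLimit

/-- **THE PROFILE CONDITION FAILS AT RATIO 134.**  The two-age profile `L_1 = 1`, `L_134 = 17∕5` (≈ `134^{1∕4}`), all other weights `0`, has
`Σ_{j<135} L_j∕P_j = 1∕(√(1∕2) + (17∕5)√(1∕135)) + (17∕5)∕(√(134∕135) + (17∕5)√(1∕2)) > 2.0001 > 2` (`P_j = Σ_k L_k√(j∕(j+k))`): (E58b)'s profile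
condition, which holds for EVERY profile on a window of ratio `≤ 133` (`…ComparisonKernelChord.profileSum_le_two_of_window_133`), covers no window of
ratio `134` — the factor `133` is the profile condition's own limit (comparison (E58′) itself is NOT refuted there: the condition is only sufficient).
[folklore] -/
theorem two_lt_profileSum_ratio_134 :
    ∃ L : ℕ → ℝ, (∀ k, 0 ≤ L k) ∧ (∀ k, k ≠ 0 → L k ≠ 0 → 1 ≤ k ∧ k ≤ 134 * 1) ∧
      2 < ∑ j ∈ range 135, L j / ∑ k ∈ range 135, L k * Real.sqrt ((j : ℝ) / ((j : ℝ) + k)) := by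
  set L : ℕ → ℝ := fun k => (if k = 1 then 1 else 0) + (if k = 134 then 17 / 5 else 0) with hL
  refine ⟨L, fun k => by simp only [hL]; split_ifs <;> norm_num, fun k hk hLk => ?_, ?_⟩
  · simp only [hL] at hLk
    by_cases h1 : k = 1
    · subst h1; norm_num
    by_cases h2 : k = 134
    · subst h2; norm_num
    simp [h1, h2] at hLk
  -- the reads `P_j = √(j∕(j+1)) + (17∕5)·√(j∕(j+134))`
  have h1m : (1 : ℕ) ∈ range 135 := by simp
  have h134m : (134 : ℕ) ∈ range 135 := by simp
  have hP : ∀ j : ℕ, ∑ k ∈ range 135, L k * Real.sqrt ((j : ℝ) / ((j : ℝ) + k))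
      = Real.sqrt ((j : ℝ) / ((j : ℝ) + 1)) + 17 / 5 * Real.sqrt ((j : ℝ) / ((j : ℝ) + 134)) := by
    intro j
    simp only [hL, add_mul, sum_add_distrib, ite_mul, zero_mul, sum_ite_eq', h1m, h134m, if_true]
    push_cast
    ring
  simp_rw [hP]
  -- the outer sum has the two non-zero terms `j = 1` and `j = 134`
  have hsplit : ∀ j : ℕ, L j / (Real.sqrt ((j : ℝ) / ((j : ℝ) + 1)) + 17 / 5 * Real.sqrt ((j : ℝ) / ((j : ℝ) + 134)))
      = (if j = 1 then 1 / (Real.sqrt ((j : ℝ) / ((j : ℝ) + 1)) + 17 / 5 * Real.sqrt ((j : ℝ) / ((j : ℝ) + 134))) else 0)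
        + (if j = 134 then (17 / 5) / (Real.sqrt ((j : ℝ) / ((j : ℝ) + 1)) + 17 / 5 * Real.sqrt ((j : ℝ) / ((j : ℝ) + 134))) else 0) := by
    intro j
    simp only [hL]
    by_cases h1 : j = 1
    · subst h1; norm_num
    by_cases h2 : j = 134
    · subst h2; norm_num
    simp [h1, h2]
  simp_rw [hsplit]
  rw [sum_add_distrib, sum_ite_eq' (range 135) (1 : ℕ), sum_ite_eq' (range 135) (134 : ℕ), if_pos h1m, if_pos h134m]
  push_cast
  -- numerics: `P_1 < 0.999735`, `P_134 < 3.400461`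
  have e1 : ((1 : ℝ) / (1 + 1)) = 1 / 2 := by norm_num
  have e2 : ((1 : ℝ) / (1 + 134)) = 1 / 135 := by norm_num
  have e3 : ((134 : ℝ) / (134 + 1)) = 134 / 135 := by norm_num
  have e4 : ((134 : ℝ) / (134 + 134)) = 1 / 2 := by norm_num
  rw [e1, e2, e3, e4]
  have s1 : Real.sqrt (1 / 2) < 0.707107 := by
    rw [Real.sqrt_lt' (by norm_num)]; norm_num
  have s2 : Real.sqrt (1 / 135) < 0.086067 := by
    rw [Real.sqrt_lt' (by norm_num)]; norm_num
  have s3 : Real.sqrt (134 / 135) < 0.996297 := by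
    rw [Real.sqrt_lt' (by norm_num)]; norm_num
  have p1 : 0 < Real.sqrt (1 / 2) + 17 / 5 * Real.sqrt (1 / 135) := by positivity
  have p2 : 0 < Real.sqrt (134 / 135) + 17 / 5 * Real.sqrt (1 / 2) := by positivity
  have b1 : 1 / (0.999735 : ℝ) ≤ 1 / (Real.sqrt (1 / 2) + 17 / 5 * Real.sqrt (1 / 135)) :=
    div_le_div_of_nonneg_left (by norm_num) p1 (by linarith)
  have b2 : (17 / 5) / (3.400461 : ℝ) ≤ (17 / 5) / (Real.sqrt (134 / 135) + 17 / 5 * Real.sqrt (1 / 2)) :=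
    div_le_div_of_nonneg_left (by norm_num) p2 (by linarith)
  have hnum : (2 : ℝ) < 1 / 0.999735 + (17 / 5) / 3.400461 := by norm_num
  linarith

end Summit.QuantumFields.BalabanUV.Beta.EriceRemainderEnclosureHistoryAutonomyComparisonWindowLimit

end
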